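import Summits.CriticalPhenomena.CardyFormulaZ2.Theorems.SLE6LimitZ2AllDiscretisations
import Summits.CriticalPhenomena.CardyFormulaZ2.Theorems.SLE6LimitZ2
import HarnessLib

/-!
# crit-perc.S02 with the discretisations quantified: its two reductions to the canonical form

Conjecture/notion split (coordinator 2026-08-15) of
`Literature/Probability/Percolation/InterfaceScalingLimitDiscretised.lean`: that file keeps the
VOCABULARY (the bond interface `bondInterfaceIn D E` in a general discrete Dobrushin domain and
the bookkeeping `zdDiscretisationFamily_dobrushinData_iff` for the canonical data
`dobrushinData D`); the OPEN CONJECTURE crit-perc.S02 in its corrected form —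
conformal invariance of critical bond percolation on `ℤ²`, interface version, for arbitrary
admissible discretisations (posed in Smirnov, ICM 2006, §2.3, Conjecture 4 at `q = 1`; no refereed
proof, see the status check in that file) — is an obligation of our theories, canonical at the
conjecture leaf `Summit.CriticalPhenomena.CardyFormulaZ2.SLE6LimitZ2AllDiscretisations`
(`Summits/CriticalPhenomena/CardyFormulaZ2/Theorems/SLE6LimitZ2AllDiscretisations.lean`), as is
the canonical-discretisation form `Summit.CriticalPhenomena.CardyFormulaZ2.SLE6LimitZ2`
(`…/SLE6LimitZ2.lean`); both leaves contain nothing but the `@[conjecture]` defs and may be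
imported from Literature (CONVENTIONS §4).  This file carries the two declarations of
`InterfaceScalingLimitDiscretised.lean` that MENTION the conjectures, stated over the canonical
leaves:

* `convergesInLawToSLE_bondInterface_of_allDiscretisations` — the quantified conjecture yields
  the conclusion of `SLE6LimitZ2` on every Dobrushin domain whose canonical data
  `dobrushinData D` are eventually admissible AND have convergent discrete marked points (the
  second hypothesis is the geometric input isolated for crit-ising.S18 in `Sweep1Proofs.lean`, not
  known to follow from the first);
* `sle6LimitZ2_of_allDiscretisations` — hence the quantified conjecture together with that
  geometric input for every eventually admissible domain implies the canonical form
  `SLE6LimitZ2`.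

Both are proved (the canonical data then form a `ZdDiscretisationFamily`,
`zdDiscretisationFamily_dobrushinData_iff`, and `bondInterfaceIn D (dobrushinData D δ)` is
`bondInterface D δ` definitionally); no named fact is introduced, nothing here asserts or refutes
either conjecture.

## References

* S. Smirnov, *Towards conformal invariance of 2D lattice models*, ICM 2006 (arXiv:0708.0032),
  §2.1 and §2.3, Conjecture 4 at `q = 1`. [Smirnov2007ICM]
* D. Chelkak, H. Duminil-Copin, C. Hongler, A. Kemppainen, S. Smirnov, C. R. Math. 352 (2014),
  §1 (discretisation families).
-/

noncomputable section

open MeasureTheory Filter Topology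
open scoped unitInterval

namespace Literature.Probability.Percolation

section CritPerc

open LatticeModels

/-- **The quantified conjecture yields the canonical conclusion where the canonical data are a
discretisation family.** If `SLE6LimitZ2AllDiscretisations` holds (canonical leaf
`Summit.CriticalPhenomena.CardyFormulaZ2.SLE6LimitZ2AllDiscretisations`), then for every
Dobrushin domain `D` whose canonical square-lattice data `dobrushinData D δ` are admissible for
all small `δ > 0` and whose discrete marked points (midpoints of the two `A`–`B` boundary edges)
converge to `{a, b}`, the canonical bond interface `bondInterface D δ` of critical bond
percolation converges in law to chordal SLE₆ in `D` — the conclusion of `SLE6LimitZ2` at `D`.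
(Smirnov, ICM 2006, §2.3 Conjecture 4 at `q = 1`, for the conjecture; the reduction is
bookkeeping: `zdDiscretisationFamily_dobrushinData_iff` and `bondInterfaceIn_dobrushinData`.)
[cite: Smirnov2007ICM, §2.3 Conjecture 4 at q = 1] -/
theorem convergesInLawToSLE_bondInterface_of_allDiscretisations
    (h : Summit.CriticalPhenomena.CardyFormulaZ2.SLE6LimitZ2AllDiscretisations)
    (D : RandomPlanarGeometry.DobrushinDomain)
    (hadm : ∀ᶠ δ in 𝓝[>] (0 : ℝ), (dobrushinData D δ).IsZdAdmissible)
    (hpts : Tendsto (fun δ : ℝ ↦ Metric.hausdorffEDist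
      (medialPoint δ '' (dobrushinData D δ).zdABEdges) {D.pt 0, D.pt 1}) (𝓝[>] 0) (𝓝 0)) :
    RandomPlanarGeometry.ConvergesInLawToSLE 6 D (Ωδ := fun _ ↦ BondConfig (Site 2))
      (bondInterface D) fun _ ↦ bondPercolation (zdGraph 2) half := by
  have hfam : ZdDiscretisationFamily D (dobrushinData D) :=
    (zdDiscretisationFamily_dobrushinData_iff D).2 ⟨hadm, hpts⟩
  have hconv := h D (dobrushinData D) hfam
  simp only [bondInterfaceIn_dobrushinData] at hconv
  exact hconv

/-- **Corrected statement ⇒ the tree's crit-perc.S02 where the latter is meaningful.** If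
`SLE6LimitZ2AllDiscretisations` holds and, for every Dobrushin domain whose canonical data are
eventually admissible, the discrete marked points of those data converge to `{a, b}` (the
geometric input of crit-ising.S18), then `SLE6LimitZ2` holds (canonical leaf
`Summit.CriticalPhenomena.CardyFormulaZ2.SLE6LimitZ2`: the canonical-discretisation form behind
its admissibility guard). [cite: Smirnov2007ICM, §2.3 Conjecture 4 at q = 1] -/
theorem sle6LimitZ2_of_allDiscretisations
    (h : Summit.CriticalPhenomena.CardyFormulaZ2.SLE6LimitZ2AllDiscretisations)
    (hpts : ∀ D : RandomPlanarGeometry.DobrushinDomain,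
      (∀ᶠ δ in 𝓝[>] (0 : ℝ), (dobrushinData D δ).IsZdAdmissible) →
        Tendsto (fun δ : ℝ ↦ Metric.hausdorffEDist
          (medialPoint δ '' (dobrushinData D δ).zdABEdges) {D.pt 0, D.pt 1}) (𝓝[>] 0) (𝓝 0)) :
    Summit.CriticalPhenomena.CardyFormulaZ2.SLE6LimitZ2 :=
  fun D hadm ↦ convergesInLawToSLE_bondInterface_of_allDiscretisations h D hadm (hpts D hadm)

end CritPerc

end Literature.Probability.Percolation
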